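import Literature.MathematicalPhysics.QuantumFieldTheory.Balaban1983to89.B3DivergentGraphs
import Literature.MathematicalPhysics.QuantumFieldTheory.Balaban1983to89.B3Cor23ConcreteTwoDim

/-!
# `Balaban1983to89.B3ScalarLegParity` — T. Bałaban, *(Higgs)₂,₃ quantum fields in a finite volume. III. Renormalization*,
Commun. Math. Phys. **88** (1983) 411–445 [Balaban1983Higgs3]: p. 431, *"there are no graphs with one external leg of scalar
field"*, DECIDED on the concrete family of graphs `B3Cor23Concrete.Graph`

statement-level skeleton of published theorems with citation tags; proofs where landed; nothing here is a claim about the Yang–Mills mass gap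

PDF held: `paper:balaban1983-higgs-2-3-quantum-fields-finite-volume` (journal page = PDF page + 410); renders read as images:
`…/b2b-balaban-ref1/pages/1983-cmp88-higgs23-III/1983-cmp88-higgs23-III-p004, p021-x2.png` (pp. 414, 431).
CITATION HEADER (lean-in-tree rule).  lit-balaban TYPED SKELETON (HOME `run/shared/lean/pub/lit-balaban/`), Phase 2, seat p18
(gen 2), unit `lit-balaban-p18`: SKELETON row **B3.Txt@431** (pp. 431–432 "remaining classes"), first sentence, p. 431 [PDF 21]:
*"There are no graphs with one external leg of scalar field and one external leg of vector field, and there are no graphs with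
one external leg of scalar field [more exactly every such graph necessarily has a vertex of the form (1.13), (1.14) or (1.15)]."*
Model: `B3Cor23Concrete` (seat p18 gen 1); leg counts `B3DivergentGraphs.numExtScalarLegs`.

WHAT THIS MODULE PROVES (sorry-free; one `def` with body = the set of internal φ′-legs; no `Prop` fact introduced).  The φ′-legs on
internal lines pair up under «the other endpoint» (p. 414: *"the remaining are again divided into pairs"*), a fixed-point-free
involution, so they are even in number (`even_card_intScalarLegSet`); the catalogue vertices other than (1.13)–(1.15) have an even
number of φ′-legs; hence (`hasVertex1315_of_odd_numExtScalarLegs`) a graph with an ODD number of external scalar legs — in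
particular exactly one (`hasVertex1315_of_numExtScalarLegs_eq_one`), with or without external vector legs — has a vertex of the
form (1.13)–(1.15): the printed bracket, PROVED for every graph of the model; with Cor. 2.3 first clause (seat p18 gen 1,
`B3Cor23ConcreteProof` / `B3Cor23ConcreteTwoDim`) such a graph has D(G) > 0 in d = 3 and in d = 2, i.e. it is not divergent
(`deg_pos_of_odd_numExtScalarLegs`, `_d2`, `numExtScalarLegs_ne_one_of_deg_nonpos`, `even_numExtScalarLegs_of_deg_nonpos`).
NOT here: the other sentences of pp. 431–432 (graphs with one / three external vector legs "do not introduce any new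
divergences"; the formation of the classes G_ren) — class-formation prose, no formula content on the model.
-/

namespace Literature.MathematicalPhysics.QuantumFieldTheory.Balaban1983to89.B3ScalarLegParity

open Finset B3Prop1 B3Sect2Statements B3VertexBridge B3Cor23Concrete B3DivergentGraphs

variable {nbar : ℕ} (G : Graph nbar)

/-! ## p. 431: the φ′-legs pair up — no graph with one external scalar leg -/

/-- The internal φ′-legs of G (the φ′-legs lying on internal lines). [cite: Balaban1983Higgs3, p.414] -/
def intScalarLegSet : Finset (Leg G.kind) := univ.filter fun x => x.2.isLeft = true ∧ (G.other x).isSome = true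

/-- kernel: the internal φ′-legs counted vertex by vertex. [cite: Balaban1983Higgs3, (2.1) p.422] -/
theorem card_intScalarLegSet : (intScalarLegSet G).card = ∑ i, G.intScalar i := by
  unfold intScalarLegSet Graph.intScalar
  rw [card_filter, Fintype.sum_sigma]
  refine sum_congr rfl fun i _ => ?_
  rw [Fintype.sum_sum_type, card_filter]
  simp

/-- p. 414 [PDF 4], verbatim: *"Some φ′-legs are replaced by external scalar fields and the remaining are again divided into
pairs and each pair is replaced by a propagator"* — kernel: the internal φ′-legs of a graph of the model are EVEN in number
(«the other endpoint» is a fixed-point-free involution on them). [cite: Balaban1983Higgs3, p.414] -/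
theorem even_card_intScalarLegSet : Even (intScalarLegSet G).card := by
  have hget : ∀ a (ha : a ∈ intScalarLegSet G), G.other a = some ((G.other a).get (mem_filter.mp ha).2.2) :=
    fun a ha => (Option.some_get _).symm
  have hsum : ∑ x ∈ intScalarLegSet G, (1 : ZMod 2) = 0 := by
    refine sum_involution (fun a ha => (G.other a).get (mem_filter.mp ha).2.2) (fun a ha => by decide)
      (fun a ha _ => ?_) (fun a ha => ?_) (fun a ha => ?_)
    · intro heq
      exact G.other_ne a a (by rw [hget a ha, heq]) rfl
    · have hmem := mem_filter.mp ha
      refine mem_filter.mpr ⟨mem_univ _, ?_, ?_⟩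
      · rw [← G.other_isLeft _ _ (hget a ha)]; exact hmem.2.1
      · rw [G.other_symm _ _ (hget a ha)]; rfl
    · have := G.other_symm _ _ (hget a ha)
      simp [this]
  have hcard : ((intScalarLegSet G).card : ZMod 2) = 0 := by
    rw [← hsum, sum_const, nsmul_eq_mul, mul_one]
  exact ZMod.natCast_eq_zero_iff_even.mp hcard

/-- kernel: (φ′-legs of the vertices) = (external φ′-legs) + (internal φ′-legs). [cite: Balaban1983Higgs3, p.414] -/
theorem sum_scalarLegs_eq : ∑ i, (G.kind i).scalarLegs = numExtScalarLegs G + (intScalarLegSet G).card := by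
  rw [card_intScalarLegSet, numExtScalarLegs, ← sum_add_distrib]
  exact sum_congr rfl fun i _ => (Nat.sub_add_cancel (G.intScalar_le i)).symm

/-- kernel: the catalogue vertices NOT of the form (1.13)–(1.15) have an even number of φ′-legs (4 for (1.6), 2 for
(1.7)–(1.11)); (1.13)–(1.15) have one. [cite: Balaban1983Higgs3, (1.6)–(1.15) pp.413–414] -/
theorem even_scalarLegs (v : VertexKind) (h : v.isOfForm1315 = false) : Even v.scalarLegs := by
  cases v <;> first | (simp only [VertexKind.scalarLegs]; decide) | simp [VertexKind.isOfForm1315] at h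

/-- p. 431 [PDF 21], verbatim: *"There are no graphs with one external leg of scalar field and one external leg of vector
field, and there are no graphs with one external leg of scalar field [more exactly every such graph necessarily has a vertex
of the form (1.13), (1.14) or (1.15)]."* — the bracket PROVED for every graph of the model, in the form: an ODD number of
external scalar legs forces a vertex of the form (1.13)–(1.15) (parity of the φ′-leg pairing). [cite: Balaban1983Higgs3, p.431] -/
theorem hasVertex1315_of_odd_numExtScalarLegs (hodd : Odd (numExtScalarLegs G)) : G.HasVertex1315 := by
  by_contra h
  have heven : Even (∑ i, (G.kind i).scalarLegs) :=
    even_sum _ fun i _ => even_scalarLegs _ (by simpa using fun hc => h ⟨i, hc⟩)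
  rw [sum_scalarLegs_eq] at heven
  exact Nat.not_even_iff_odd.mpr hodd ((Nat.even_add.mp heven).mpr (even_card_intScalarLegSet G))

/-- p. 431, the case named there: a graph with exactly one external scalar leg has a vertex of the form (1.13)–(1.15).
[cite: Balaban1983Higgs3, p.431] -/
theorem hasVertex1315_of_numExtScalarLegs_eq_one (h1 : numExtScalarLegs G = 1) : G.HasVertex1315 :=
  hasVertex1315_of_odd_numExtScalarLegs G (h1 ▸ odd_one)

/-- p. 431 with Cor. 2.3 (first clause), d = 3: a graph with an odd number of external scalar legs — e.g. one scalar leg, or one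
scalar and one vector leg — has D(G) > 0, so *"there are no [divergent] graphs with one external leg of scalar field"*.
[cite: Balaban1983Higgs3, p.431] -/
theorem deg_pos_of_odd_numExtScalarLegs (hodd : Odd (numExtScalarLegs G)) : 0 < G.deg 3 :=
  B3Cor23ConcreteProof.deg_pos_of_hasVertex1315 G (hasVertex1315_of_odd_numExtScalarLegs G hodd)

/-- The same in d = 2 (*"In d = 2 graphs are more convergent"*, p. 429; first clause of Cor. 2.3 at d = 2, seat p18 gen 1).
[cite: Balaban1983Higgs3, p.431] -/
theorem deg_pos_of_odd_numExtScalarLegs_d2 (hodd : Odd (numExtScalarLegs G)) : 0 < G.deg 2 :=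
  B3Cor23ConcreteTwoDim.deg_pos_of_hasVertex1315 G (hasVertex1315_of_odd_numExtScalarLegs G hodd)

/-- p. 431: no divergent graph (D(G) ≤ 0, d = 3) has exactly one external scalar leg, whatever its vector legs.
[cite: Balaban1983Higgs3, p.431] -/
theorem numExtScalarLegs_ne_one_of_deg_nonpos (hD : G.deg 3 ≤ 0) : numExtScalarLegs G ≠ 1 := fun h1 => by
  linarith [deg_pos_of_odd_numExtScalarLegs G (h1 ▸ odd_one)]

/-- p. 431: in a divergent graph the number of external scalar legs is even (0, 2 or 4 by `nV_add_ext_le_six`).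
[cite: Balaban1983Higgs3, p.431] -/
theorem even_numExtScalarLegs_of_deg_nonpos (hD : G.deg 3 ≤ 0) : Even (numExtScalarLegs G) := by
  by_contra h
  linarith [deg_pos_of_odd_numExtScalarLegs G (Nat.not_even_iff_odd.mp h)]

end Literature.MathematicalPhysics.QuantumFieldTheory.Balaban1983to89.B3ScalarLegParity
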